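import Summits.AtomisticToContinuum.BoseEinsteinCondensation.Theorems.LatticeODLROOffHalfFilling.Negative.SaturationCertificate
import Literature.MathematicalPhysics.QuantumLattice.XYZGroundStateOrderCorrIneq

/-!
# Crux `LatticeODLROOffHalfFilling` — no ODLRO above the saturation field, and the `μ ↦ −μ` symmetry

Crux-disprover results for `stmt-AtomisticToContinuum-11033` (route BECGroundStateSOS), part 2
of 2 (part 1: `SaturationCertificate.lean`), landed from the work file
`Cruxes/LatticeODLROOffHalfFilling/Disproof.lean`:

* `latticeODLRO_iff` — the crux is `∃ μ₀ > 0, ∀ |μ| < μ₀, LROAt μ` (`Iff.rfl`), `LROAt μ` the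
  `μ`-slice (tracial ground-state ODLRO of `H_{L,μ} = −Σ_{⟨xy⟩}(S¹_xS¹_y + S²_xS²_y) − μS³_tot`
  along the even tori `(ℤ/2kℤ)³`);
* `lroAt_zero` — CALIBRATION: the `μ = 0` slice is the in-tree Kennedy–Lieb–Shastry theorem
  (`kennedy_lieb_shastry_xy_ground_holds`, `d = 3`, `S = ½`);
* `flip_conj_hmu`, `corr_neg_mu`, `lroAt_neg_iff`, `forall_abs_lt_iff` — the flip `U = ⨂σˣ`
  gives `U H_{L,μ} Uᴴ = H_{L,−μ}`, the two-point function and `LROAt` are EVEN in `μ`: provers may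
  assume `0 ≤ μ < μ₀`;
* `corr_eq` — for `μ > 3`, `L ≥ 3`: `Re Σ_{α=1,2} ω(S^α_xS^α_y) = ½δ_{xy}` (from `hmu_decomp`);
* `not_lroAt_of_three_lt`, `not_lroAt_of_lt_neg_three`, `latticeODLRO_false_without_smallMu`,
  `mu0_le_three` — ANY PROOF OF THE CRUX MUST USE `|μ| < μ₀` WITH `μ₀ ≤ 3`: the strengthening
  "ODLRO at every `μ`" is false (the `k`-th liminf term equals `1/(16k³)` for `|μ| > 3`,
  `orderParam_eq`);
* `orderParam_nonneg` — every liminf term is `≥ 0` (positivity of the tracial ground state on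
  `Σ_α (S^α_tot)²`): the crux cannot be refuted by a finite-`k` computation.
All [folklore] (saturation of the `S = ½` XY ferromagnet / empty or full hard-core lattice gas).
-/

noncomputable section

namespace Summit.AtomisticToContinuum.BoseEinsteinCondensation.Theorems.LatticeODLROOffHalfFilling.Negative

open Literature.MathematicalPhysics.QuantumLattice Literature.Probability.LatticeModels Matrix Finset
open scoped ComplexOrder BigOperators

/-! ### The `μ ↦ −μ` symmetry (π-rotation about the 1-axis on every site) -/

section Symmetry

variable {Λ : Type*} [Fintype Λ] [DecidableEq Λ]

/-- The global spin flip `U = ⨂_x σˣ_x` (rotation by `π` about the 1-axis, up to a phase):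
`S¹ ↦ S¹`, `S² ↦ −S²`, `S³ ↦ −S³`; in boson language the particle–hole map. [folklore] -/
def flipOp : Op Λ 2 := productOp fun _ : Λ => spinHalfPauli 0

/-- `σˣ (σˣ)ᴴ = 1`. [folklore] -/
theorem pauliX_mul_conjTranspose : spinHalfPauli 0 * (spinHalfPauli 0)ᴴ = 1 := by
  ext i j
  fin_cases i <;> fin_cases j <;> simp [spinHalfPauli, Matrix.mul_apply, conjTranspose_apply]

/-- `(σˣ)ᴴ σˣ = 1`. [folklore] -/
theorem pauliX_conjTranspose_mul : (spinHalfPauli 0)ᴴ * spinHalfPauli 0 = 1 := by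
  ext i j
  fin_cases i <;> fin_cases j <;> simp [spinHalfPauli, Matrix.mul_apply, conjTranspose_apply]

/-- `σˣ σ^α (σˣ)ᴴ = ε_α σ^α` with `ε = (1, −1, −1)`. [folklore] -/
theorem pauliX_conj_spinHalfPauli (α : Fin 3) :
    spinHalfPauli 0 * spinHalfPauli α * (spinHalfPauli 0)ᴴ =
      (if α = 0 then (1 : ℂ) else -1) • spinHalfPauli α := by
  ext i j
  fin_cases α <;> fin_cases i <;> fin_cases j <;>
    simp [spinHalfPauli, Matrix.mul_apply, conjTranspose_apply]

/-- `σˣ S^α (σˣ)ᴴ = ε_α S^α` for spin ½. [folklore] -/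
theorem pauliX_conj_spinVec (α : Fin 3) :
    spinHalfPauli 0 * spinVec 1 α * (spinHalfPauli 0)ᴴ =
      (if α = 0 then (1 : ℂ) else -1) • spinVec 1 α := by
  rw [spinVec_one_eq_half_spinHalfPauli, Matrix.mul_smul, Matrix.smul_mul,
    pauliX_conj_spinHalfPauli, smul_comm]

/-- `U S^α_x Uᴴ = ε_α S^α_x`. [folklore] -/
theorem flip_conj_siteSpin (x : Λ) (α : Fin 3) :
    flipOp * siteSpin 1 x α * flipOpᴴ = (if α = 0 then (1 : ℂ) else -1) • siteSpin 1 x α := by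
  rw [flipOp, productOp_conj_siteSpin (fun _ => pauliX_mul_conjTranspose), pauliX_conj_spinVec,
    onSite_smul', siteSpin]

/-- The XY bond operator is flip-invariant: `U (S¹_xS¹_y + S²_xS²_y) Uᴴ = S¹_xS¹_y + S²_xS²_y`.
[folklore] -/
theorem flip_conj_hop (x y : Λ) : flipOp * hop x y * flipOpᴴ = hop x y := by
  have hu : ∀ _z : Λ, (spinHalfPauli 0)ᴴ * spinHalfPauli 0 = 1 := fun _ => pauliX_conjTranspose_mul
  rw [hop, Matrix.mul_add, Matrix.add_mul, flipOp, productOp_conj_mul hu, productOp_conj_mul hu,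
    ← flipOp, flip_conj_siteSpin, flip_conj_siteSpin, flip_conj_siteSpin, flip_conj_siteSpin]
  simp

/-- `U S³_tot Uᴴ = −S³_tot`. [folklore] -/
theorem flip_conj_totalSpin_two : flipOp * (totalSpin 1 2 : Op Λ 2) * flipOpᴴ = -totalSpin 1 2 := by
  unfold totalSpin
  rw [Finset.mul_sum, Finset.sum_mul, ← Finset.sum_neg_distrib]
  refine Finset.sum_congr rfl fun x _ => ?_
  rw [flip_conj_siteSpin]
  simp

/-- `U Uᴴ = 1`. [folklore] -/
theorem flipOp_mul_conjTranspose : (flipOp : Op Λ 2) * flipOpᴴ = 1 :=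
  productOp_mul_conjTranspose fun _ => pauliX_mul_conjTranspose

/-- `Uᴴ U = 1`. [folklore] -/
theorem flipOp_conjTranspose_mul : (flipOp : Op Λ 2)ᴴ * flipOp = 1 :=
  productOp_conjTranspose_mul fun _ => pauliX_conjTranspose_mul

variable (L : ℕ) [NeZero L]

/-- **`U H_{L,μ} Uᴴ = H_{L,−μ}`** (`L ≥ 3`): the flip reverses the chemical potential. [folklore] -/
theorem flip_conj_hmu (hL : 3 ≤ L) (μ : ℝ) : flipOp * Hmu L μ * flipOpᴴ = Hmu L (-μ) := by
  rw [Hmu, Hmu, xxz_eq L hL, Matrix.mul_sub, Matrix.sub_mul, Matrix.mul_smul, Matrix.smul_mul,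
    flip_conj_totalSpin_two, Matrix.mul_neg, Matrix.neg_mul, Finset.mul_sum, Finset.sum_mul]
  simp_rw [Finset.mul_sum, Finset.sum_mul, flip_conj_hop]
  rw [Complex.ofReal_neg, neg_smul, smul_neg]

/-- **The crux's two-point function is even in `μ`** (`L ≥ 3`):
`Re Σ_α ω_{L,−μ}(S^α_xS^α_y) = Re Σ_α ω_{L,μ}(S^α_xS^α_y)` (covariance of the tracial ground state
under the flip, `groundStateFunctional_unitary_conj`). So provers may assume `μ > 0`. [folklore] -/
theorem corr_neg_mu (hL : 3 ≤ L) (μ : ℝ) (x y : TorusSite 3 L) :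
    (∑ α : Fin 2, (Hmu L (-μ)).groundStateFunctional
        (siteSpin 1 x (Fin.castSucc α) * siteSpin 1 y (Fin.castSucc α))).re =
      (∑ α : Fin 2, (Hmu L μ).groundStateFunctional
        (siteSpin 1 x (Fin.castSucc α) * siteSpin 1 y (Fin.castSucc α))).re := by
  rw [Fin.sum_univ_two, Fin.sum_univ_two, ← map_add, ← map_add]
  change ((Hmu L (-μ)).groundStateFunctional (hop x y)).re =
    ((Hmu L μ).groundStateFunctional (hop x y)).re
  rw [← flip_conj_hmu L hL μ]
  conv_lhs => rw [← flip_conj_hop x y]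
  rw [groundStateFunctional_unitary_conj flipOp_mul_conjTranspose flipOp_conjTranspose_mul]

end Symmetry

/-! ### Ground-state consequences above saturation (`μ > 3`) -/

section Saturated

variable (L : ℕ) [NeZero L]

/-- Above the saturation field no site is ever down in the (tracial) ground state:
`Re ω(P↓_x) = 0` for every `x` (`L ≥ 3`, `μ > 3`). Proof = the SOS certificate `hmu_decomp`
evaluated in `ω` against the variational bound `groundEnergy_hmu_le`. [folklore] -/
theorem re_gsf_Pd_eq_zero (hL : 3 ≤ L) {μ : ℝ} (hμ : 3 < μ) (x : TorusSite 3 L) :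
    ((Hmu L μ).groundStateFunctional (Pd x)).re = 0 := by
  have hH : (Hmu L μ).IsHermitian := Hmu_isHermitian L μ
  set ω := (Hmu L μ).groundStateFunctional with hω
  have hP : ∀ z : TorusSite 3 L, 0 ≤ (ω (Pd z)).re := fun z => by
    rw [← E_conjTranspose_mul_E]
    exact (Complex.nonneg_iff.mp (groundStateFunctional_nonneg (Hmu L μ) (E z))).1
  have hQ : ∀ (z : TorusSite 3 L) (i : Fin 3),
      0 ≤ (ω ((E z - E (z + Pi.single i 1))ᴴ * (E z - E (z + Pi.single i 1)))).re := fun z i =>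
    (Complex.nonneg_iff.mp (groundStateFunctional_nonneg (Hmu L μ) _)).1
  have hE : ω (Hmu L μ) = ((Hmu L μ).groundEnergy : ℂ) := groundStateFunctional_hamiltonian hH
  have h1 : ω 1 = 1 := groundStateFunctional_one hH
  have hdec := congrArg (fun A => (ω A).re) (hmu_decomp L hL μ)
  simp only [map_add, LinearMap.map_smul, map_sum, smul_eq_mul, h1, mul_one, Complex.add_re,
    Complex.re_ofReal_mul, Complex.re_sum, hE, Complex.ofReal_re] at hdec
  have hle := groundEnergy_hmu_le L hL μ
  have hsumQ : 0 ≤ ∑ z : TorusSite 3 L, ∑ i : Fin 3,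
      (ω ((E z - E (z + Pi.single i 1))ᴴ * (E z - E (z + Pi.single i 1)))).re :=
    Finset.sum_nonneg fun z _ => Finset.sum_nonneg fun i _ => hQ z i
  have hsumP : ∑ z : TorusSite 3 L, (ω (Pd z)).re ≤ 0 := by
    by_contra hcon
    push Not at hcon
    have : 0 < (μ - 3) * ∑ z : TorusSite 3 L, (ω (Pd z)).re := mul_pos (by linarith) hcon
    linarith
  have hsum0 : ∑ z : TorusSite 3 L, (ω (Pd z)).re = 0 :=
    le_antisymm hsumP (Finset.sum_nonneg fun z _ => hP z)
  exact (Finset.sum_eq_zero_iff_of_nonneg (fun z _ => hP z)).mp hsum0 x (Finset.mem_univ x)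

/-- **The hopping correlation above saturation**: `Re ω(S¹_xS¹_y + S²_xS²_y) = ½δ_{xy}`
(`L ≥ 3`, `μ > 3`): off the diagonal both SOS identities `hop_eq_sub`, `hop_eq_add` and
`Re ω(P↓) = 0` squeeze it to `0`; on the diagonal `(S^α)² = ¼`. [folklore] -/
theorem re_gsf_hop_eq (hL : 3 ≤ L) {μ : ℝ} (hμ : 3 < μ) (x y : TorusSite 3 L) :
    ((Hmu L μ).groundStateFunctional (hop x y)).re = if x = y then 1 / 2 else 0 := by
  have hH : (Hmu L μ).IsHermitian := Hmu_isHermitian L μ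
  set ω := (Hmu L μ).groundStateFunctional with hω
  have h1 : ω 1 = 1 := groundStateFunctional_one hH
  have hhalf : (1 / 2 : ℂ) = ((1 / 2 : ℝ) : ℂ) := by norm_num
  split_ifs with hxy
  · subst hxy
    rw [hop, siteSpin_mul_self, siteSpin_mul_self, ← add_smul, LinearMap.map_smul, h1,
      smul_eq_mul, mul_one]
    norm_num
  · have hPx := re_gsf_Pd_eq_zero L hL hμ x
    have hPy := re_gsf_Pd_eq_zero L hL hμ y
    have hup : (ω (hop x y)).re ≤ 0 := by
      have key := hop_eq_sub hxy
      rw [hhalf] at key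
      have h := congrArg (fun A => (ω A).re) key
      simp only [map_sub, map_add, LinearMap.map_smul, smul_eq_mul, Complex.sub_re,
        Complex.add_re, Complex.re_ofReal_mul] at h
      have hQ := (Complex.nonneg_iff.mp (groundStateFunctional_nonneg (Hmu L μ) (E x - E y))).1
      rw [h, hPx, hPy]
      linarith
    have hlo : 0 ≤ (ω (hop x y)).re := by
      have key := hop_eq_add hxy
      rw [hhalf] at key
      have h := congrArg (fun A => (ω A).re) key
      simp only [map_sub, map_add, LinearMap.map_smul, smul_eq_mul, Complex.sub_re,
        Complex.add_re, Complex.re_ofReal_mul] at h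
      have hQ := (Complex.nonneg_iff.mp (groundStateFunctional_nonneg (Hmu L μ) (E x + E y))).1
      rw [h, hPx, hPy]
      linarith
    exact le_antisymm hup hlo

/-- **The crux's two-point function above saturation, in closed form**: for `L ≥ 3` and
`μ > 3`, `Re Σ_{α=1,2} ω_{H_{L,μ}}(S^α_x S^α_y) = ½ δ_{xy}` — no off-diagonal order at all,
let alone long-range order. [folklore] -/
theorem corr_eq (hL : 3 ≤ L) {μ : ℝ} (hμ : 3 < μ) (x y : TorusSite 3 L) :
    (∑ α : Fin 2, (Hmu L μ).groundStateFunctional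
        (siteSpin 1 x (Fin.castSucc α) * siteSpin 1 y (Fin.castSucc α))).re =
      if x = y then 1 / 2 else 0 := by
  rw [Fin.sum_univ_two, ← map_add]
  exact re_gsf_hop_eq L hL hμ x y

end Saturated

/-! ### The crux, its `μ`-slices, and the refuted strengthening -/

section Crux

/-- The `μ`-slice of the crux: long-range order of the tracial ground states of `H_{L,μ}` along
the even tori `(ℤ/2kℤ)³` — VERBATIM the matrix of `LatticeODLROOffHalfFilling` after `∀ μ`
(a definition, the crux's own predicate sliced at `μ`; not a cited fact). -/
def LROAt (μ : ℝ) : Prop :=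
  0 < Filter.liminf (fun k : ℕ => (∑ x ∈ halfOpenBox 3 (2 * k), ∑ y ∈ halfOpenBox 3 (2 * k),
    torusPullback (d := 3) (fun L x y => if hL : L = 0 then 0 else (haveI : NeZero L := ⟨hL⟩;
      (∑ α : Fin 2, (xxzHamiltonian 1 (torusGraph 3 L) (-1) 0 -
        (μ : ℂ) • totalSpin 1 2).groundStateFunctional
        (siteSpin 1 x (Fin.castSucc α) * siteSpin 1 y (Fin.castSucc α))).re)) (2 * k) x y) /
      ((halfOpenBox 3 (2 * k)).card : ℝ) ^ 2) Filter.atTop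

/-- The crux is `∃ μ₀ > 0, ∀ |μ| < μ₀, LROAt μ` — definitionally. [folklore] -/
theorem latticeODLRO_iff :
    Theses.BECGroundStateSOS.LatticeODLROOffHalfFilling ↔
      ∃ μ₀ : ℝ, 0 < μ₀ ∧ ∀ μ : ℝ, |μ| < μ₀ → LROAt μ := Iff.rfl

/-- **Calibration (μ = 0 is PROVED):** the half-filling slice of the crux is exactly the in-tree
Kennedy–Lieb–Shastry theorem (`d = 3`, `S = ½`): the sign conventions, the component indexing
(`Fin.castSucc` vs `Fin.castLE`) and the normalisation of the crux agree with `XYOrder.lean`.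
[cite: KLS1988PRL, Theorem] -/
theorem lroAt_zero : LROAt 0 := by
  have h := kennedy_lieb_shastry_xy_ground_holds 3 (by norm_num) 1 le_rfl
  unfold HasEvenTorusLRO groundStateXYCorrTorus HasLongRangeOrder at h
  unfold LROAt
  simp only [Complex.ofReal_zero, zero_smul, sub_zero]
  exact h

/-- **The normalised order parameter above saturation, exactly**: for `μ > 3` and `k ≥ 2` the
`k`-th term of the crux's `liminf` is `|Λ|/2 / |Λ|² = 1/(16 k³)`. [folklore] -/
theorem orderParam_eq {μ : ℝ} (hμ : 3 < μ) {k : ℕ} (hk : 2 ≤ k) :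
    (∑ x ∈ halfOpenBox 3 (2 * k), ∑ y ∈ halfOpenBox 3 (2 * k),
      torusPullback (d := 3) (fun L x y => if hL : L = 0 then 0 else (haveI : NeZero L := ⟨hL⟩;
        (∑ α : Fin 2, (xxzHamiltonian 1 (torusGraph 3 L) (-1) 0 -
          (μ : ℂ) • totalSpin 1 2).groundStateFunctional
          (siteSpin 1 x (Fin.castSucc α) * siteSpin 1 y (Fin.castSucc α))).re)) (2 * k) x y) /
      ((halfOpenBox 3 (2 * k)).card : ℝ) ^ 2 = 1 / (16 * (k : ℝ) ^ 3) := by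
  have hL0 : 2 * k ≠ 0 := by omega
  haveI : NeZero (2 * k) := ⟨hL0⟩
  have hL3 : 3 ≤ 2 * k := by omega
  have hcard : Fintype.card (TorusSite 3 (2 * k)) = (2 * k) ^ 3 := by
    simp [ZMod.card, Fintype.card_fin]
  simp only [torusPullback_apply, dif_neg hL0]
  rw [sum_sq_halfOpenBox_comp_torusProj (fun s t : TorusSite 3 (2 * k) =>
    (∑ α : Fin 2, (Hmu (2 * k) μ).groundStateFunctional
      (siteSpin 1 s (Fin.castSucc α) * siteSpin 1 t (Fin.castSucc α))).re)]
  simp only [corr_eq (2 * k) hL3 hμ, Finset.sum_ite_eq, Finset.mem_univ, if_true,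
    Finset.sum_const, Finset.card_univ, hcard, card_halfOpenBox, nsmul_eq_mul]
  push_cast
  have hk0 : (k : ℝ) ≠ 0 := by exact_mod_cast (show k ≠ 0 by omega)
  field_simp
  ring

/-- **REFUTED STRENGTHENING / load-bearing smallness of `μ`.** No slice above the saturation
field has long-range order: `¬ LROAt μ` for every `μ > 3`. Witness: the fully polarised product
state is the unique ground state of `H_{L,μ}` for `μ > 3` (SOS certificate `hmu_decomp`), its
order parameter is `1/(16k³) → 0`. [folklore] -/
theorem not_lroAt_of_three_lt {μ : ℝ} (hμ : 3 < μ) : ¬ LROAt μ := by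
  intro h
  unfold LROAt at h
  obtain ⟨f, hf, hfk⟩ : ∃ f : ℕ → ℝ, 0 < Filter.liminf f Filter.atTop ∧
      ∀ k : ℕ, 2 ≤ k → f k = 1 / (16 * (k : ℝ) ^ 3) :=
    ⟨_, h, fun k hk => orderParam_eq hμ hk⟩
  have hlim : Filter.Tendsto (fun k : ℕ => 1 / (16 * (k : ℝ) ^ 3)) Filter.atTop (nhds 0) :=
    tendsto_const_nhds.div_atTop (Filter.Tendsto.const_mul_atTop (by norm_num)
      ((Filter.tendsto_pow_atTop (by norm_num)).comp tendsto_natCast_atTop_atTop))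
  have hlim' : Filter.Tendsto f Filter.atTop (nhds 0) :=
    hlim.congr' ((Filter.eventually_ge_atTop 2).mono fun k hk => (hfk k hk).symm)
  rw [hlim'.liminf_eq] at hf
  exact lt_irrefl 0 hf

/-- **Any proof of the crux must use `|μ| < μ₀` with `μ₀ ≤ 3`**: the strengthening to all `μ`
is false (witness `μ = 4`, above the saturation field `|μ| = 3` of the `S = ½` XY model on the
cubic lattice, coordination number `6`); `∀ μ, LROAt μ` is the crux with the smallness hypothesis
`|μ| < μ₀` dropped. [folklore] -/
theorem latticeODLRO_false_without_smallMu : ¬ ∀ μ : ℝ, LROAt μ := fun h =>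
  not_lroAt_of_three_lt (by norm_num : (3 : ℝ) < 4) (h 4)

/-- Equivalent reading: whatever `μ₀` a proof of the crux produces satisfies `μ₀ ≤ 3`
(the window cannot reach past saturation). [folklore] -/
theorem mu0_le_three {μ₀ : ℝ} (h : ∀ μ : ℝ, |μ| < μ₀ → LROAt μ) : μ₀ ≤ 3 := by
  by_contra hlt
  push Not at hlt
  obtain ⟨μ, h3, hμ⟩ : ∃ μ : ℝ, 3 < μ ∧ μ < μ₀ := exists_between hlt
  exact not_lroAt_of_three_lt h3 (h μ (by rw [abs_of_pos (by linarith)]; exact hμ))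

/-- **Each `liminf` term of the crux is `≥ 0`** (every `μ`, every `k`): the double sum is
`Re Σ_α ω((S^α_tot)²) ≥ 0` by positivity of the tracial ground state. So `¬ LROAt μ` means the
`liminf` is exactly `0`, never negative, and no finite-`k` computation can refute the crux. [folklore] -/
theorem orderParam_nonneg (μ : ℝ) (k : ℕ) :
    0 ≤ (∑ x ∈ halfOpenBox 3 (2 * k), ∑ y ∈ halfOpenBox 3 (2 * k),
      torusPullback (d := 3) (fun L x y => if hL : L = 0 then 0 else (haveI : NeZero L := ⟨hL⟩;
        (∑ α : Fin 2, (xxzHamiltonian 1 (torusGraph 3 L) (-1) 0 -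
          (μ : ℂ) • totalSpin 1 2).groundStateFunctional
          (siteSpin 1 x (Fin.castSucc α) * siteSpin 1 y (Fin.castSucc α))).re)) (2 * k) x y) /
      ((halfOpenBox 3 (2 * k)).card : ℝ) ^ 2 := by
  refine div_nonneg ?_ (by positivity)
  rcases Nat.eq_zero_or_pos k with rfl | hk
  · simp
  have hL0 : 2 * k ≠ 0 := by omega
  haveI : NeZero (2 * k) := ⟨hL0⟩
  simp only [torusPullback_apply, dif_neg hL0]
  rw [sum_sq_halfOpenBox_comp_torusProj (fun s t : TorusSite 3 (2 * k) =>
    (∑ α : Fin 2, (Hmu (2 * k) μ).groundStateFunctional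
      (siteSpin 1 s (Fin.castSucc α) * siteSpin 1 t (Fin.castSucc α))).re)]
  set ω := (Hmu (2 * k) μ).groundStateFunctional with hω
  have hH : ∀ α : Fin 3, (∑ s : TorusSite 3 (2 * k), siteSpin 1 s α).IsHermitian := fun α => by
    rw [IsHermitian, Matrix.conjTranspose_sum]
    exact Finset.sum_congr rfl fun x _ => (siteSpin_isHermitian 1 x α).eq
  have key : ∀ α : Fin 3, 0 ≤ (ω ((∑ s : TorusSite 3 (2 * k), siteSpin 1 s α) *
      ∑ t : TorusSite 3 (2 * k), siteSpin 1 t α)).re := fun α =>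
    re_groundStateFunctional_mul_self_nonneg _ (hH α)
  have step : ∀ α : Fin 3, (ω ((∑ s : TorusSite 3 (2 * k), siteSpin 1 s α) *
      ∑ t : TorusSite 3 (2 * k), siteSpin 1 t α)).re =
      ∑ s : TorusSite 3 (2 * k), ∑ t : TorusSite 3 (2 * k), (ω (siteSpin 1 s α * siteSpin 1 t α)).re := by
    intro α
    simp only [Finset.sum_mul_sum, map_sum, Complex.re_sum]
  have hre : ∀ s t : TorusSite 3 (2 * k), (∑ α : Fin 2, ω (siteSpin 1 s (Fin.castSucc α) *
      siteSpin 1 t (Fin.castSucc α))).re = ∑ α : Fin 2, (ω (siteSpin 1 s (Fin.castSucc α) *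
      siteSpin 1 t (Fin.castSucc α))).re := fun s t => Complex.re_sum _ _
  simp only [hre]
  calc (0 : ℝ) ≤ ∑ α : Fin 2, (ω ((∑ s : TorusSite 3 (2 * k), siteSpin 1 s (Fin.castSucc α)) *
        ∑ t : TorusSite 3 (2 * k), siteSpin 1 t (Fin.castSucc α))).re :=
        Finset.sum_nonneg fun α _ => key _
    _ = ∑ α : Fin 2, ∑ s : TorusSite 3 (2 * k), ∑ t : TorusSite 3 (2 * k),
          (ω (siteSpin 1 s (Fin.castSucc α) * siteSpin 1 t (Fin.castSucc α))).re :=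
        Finset.sum_congr rfl fun α _ => step _
    _ = ∑ s : TorusSite 3 (2 * k), ∑ t : TorusSite 3 (2 * k), ∑ α : Fin 2,
          (ω (siteSpin 1 s (Fin.castSucc α) * siteSpin 1 t (Fin.castSucc α))).re := by
        rw [Finset.sum_comm]
        exact Finset.sum_congr rfl fun s _ => Finset.sum_comm

/-- **`LROAt` is even in `μ`**: the `k`-th liminf terms agree for `k ≥ 2` (`corr_neg_mu`).
[folklore] -/
theorem lroAt_neg_iff (μ : ℝ) : LROAt (-μ) ↔ LROAt μ := by
  unfold LROAt
  rw [Filter.liminf_congr]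
  filter_upwards [Filter.eventually_ge_atTop 2] with k hk
  have hL0 : 2 * k ≠ 0 := by omega
  haveI : NeZero (2 * k) := ⟨hL0⟩
  have hL3 : 3 ≤ 2 * k := by omega
  simp only [torusPullback_apply, dif_neg hL0, corr_neg_mu (2 * k) hL3 μ]

/-- Hence no ODLRO below `μ < −3` either (full lattice = empty lattice of holes). [folklore] -/
theorem not_lroAt_of_lt_neg_three {μ : ℝ} (hμ : μ < -3) : ¬ LROAt μ := by
  rw [← neg_neg μ, lroAt_neg_iff]
  exact not_lroAt_of_three_lt (by linarith)

/-- The surviving window is symmetric: `(∀ |μ| < μ₀, LROAt μ) ↔ (∀ μ, 0 ≤ μ → μ < μ₀ → LROAt μ)`.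
[folklore] -/
theorem forall_abs_lt_iff (μ₀ : ℝ) :
    (∀ μ : ℝ, |μ| < μ₀ → LROAt μ) ↔ ∀ μ : ℝ, 0 ≤ μ → μ < μ₀ → LROAt μ := by
  constructor
  · intro h μ h0 h1
    exact h μ (by rwa [abs_of_nonneg h0])
  · intro h μ hμ
    rcases le_or_gt 0 μ with h0 | h0
    · exact h μ h0 (lt_of_abs_lt hμ)
    · rw [← lroAt_neg_iff]
      exact h (-μ) (by linarith) (by rwa [abs_of_neg h0] at hμ)

end Crux



end Summit.AtomisticToContinuum.BoseEinsteinCondensation.Theorems.LatticeODLROOffHalfFilling.Negative
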